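import Summits.CriticalPhenomena.SAWScalingLimit.Theorems.SAWRenewalTightnessTubeLowerBoundBPDOfSpanHyperscalingBreaks

/-!
# Sub-goal `breakPointDensity_of_spanHyperscaling` of the line `subcritical-renewal-floor`
(crux `TubeLowerBound`, stmt-CriticalPhenomena-4730), part II: moments of the tilted renewal

Word model of `SAWWords.lean` / `SAWWordBridges.lean`; continues part I (`…Breaks.lean`).  For a
tilted pair `(z, m)` write `ω(w) = z^{|w|} e^{m·span(w)}` (as an extended non-negative real,
`ENNReal.ofReal (z ^ w.length * Real.exp (m * (xEnd w : ℝ)))`, always written out) and, for `b : ℕ`,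
`Q_b` for the class of non-empty self-avoiding bridge words with exactly `b` break points (written out
as `IsSAW w ∧ IsBridgeW w ∧ w ≠ [] ∧ #breaks(w) = b`; `Q_0` = irreducible bridges,
`Q_{b+1} = {s ++ t : s ∈ Q_0, t ∈ Q_b}` bijectively by Kesten's unique factorisation).  All sums are
`tsum`s over ALL step words in `ℝ≥0∞` (no convergence bookkeeping, no definitions).

* `tsum_eq_tsum_pairs` — re-indexing a sum over `Q_{b+1}` as a sum over pairs `Q_0 × Q_b`;
* `tsum_breaks_twt`, `tsum_breaks_x_twt`, `tsum_breaks_sq_twt` — if `Σ_{Q_0} ω = 1`,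
  `Σ_{Q_0} span·ω = s₁`, `Σ_{Q_0} span²·ω = s₂` then on `Q_b` ("`b + 1` i.i.d. pieces"):
  `Σ ω = 1`, `Σ span·ω = (b+1) s₁`, `Σ span²·ω = (b+1) s₂ + (b+1) b s₁²`;
* `tsum_sq_sub_add` — the variance identity `Σ (span - a)² ω + 2a Σ span ω = Σ span² ω + a² Σ ω`;
* `sq_le_of_tsums` (Cauchy–Schwarz `S₁² ≤ S₂`), `tsum_tail_le` (CHEBYSHEV:
  `Σ_{Q_b, |span - (b+1)S₁| ≥ t} ω ≤ (b+1) S₂ / t²`), `tsum_good_add_tsum_tail`;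
* `tsum_fd_twt_le` (un-tilting: `ω(w) ≤ e^{2mD} x_c^{|w|}` for spans `< 2D`), `exists_partialSum_gt`
  (from an `ℝ≥0∞` sum over words back to the `ℕ`-indexed partial sums of the conclusion).

References: H. Kesten, J. Math. Phys. 4 (1963), §4; N. Madras, G. Slade, *The Self-Avoiding Walk*
(1993), §4.2 (the renewal structure (4.2.1)–(4.2.15)).
-/

noncomputable section

namespace Summit.CriticalPhenomena.SAWScalingLimit.Theorems.TubeLowerBound.SubcriticalRenewalFloor

open scoped BigOperators Classical ENNReal
open Literature.Probability.LatticeModels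
open Literature.Probability.RandomPlanarGeometry Literature.Probability.RandomPlanarGeometry.SAW

namespace BPD

open Finset Filter Topology Function

/-! ### Sums over pairs -/

/-- `Σ_{(s,t)} f(s) g(t) = (Σ f)(Σ g)` in `ℝ≥0∞`. [folklore] -/
theorem tsum_prod_mul (f g : List Step → ℝ≥0∞) :
    ∑' p : List Step × List Step, f p.1 * g p.2 = (∑' s, f s) * ∑' t, g t := by
  rw [ENNReal.tsum_prod', ← ENNReal.tsum_mul_right]
  refine tsum_congr fun s => ?_
  dsimp only
  rw [ENNReal.tsum_mul_left]

/-- **Re-indexing over the first factor.** A function supported on the class `Q_{b+1}` is summed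
equally over the pairs `(s, t) ∈ Q_0 × Q_b` via `(s, t) ↦ s ++ t` (a bijection onto `Q_{b+1}`:
`exists_append_of_breaks_succ`, `breaks_append`, `SAW.eq_of_append_eq'`). [cite: Kesten1963SAW, §4] -/
theorem tsum_eq_tsum_pairs (b : ℕ) (H : List Step → ℝ≥0∞) (hH : ∀ w, H w ≠ 0 → (IsSAW w ∧ IsBridgeW w ∧ w ≠ [] ∧ ((Finset.range w.length).filter (fun j => IsBreak w j)).card = b + 1)) :
    ∑' w, H w =
      ∑' p : List Step × List Step, (if IsIrrBridge p.1 ∧ (IsSAW p.2 ∧ IsBridgeW p.2 ∧ p.2 ≠ [] ∧ ((Finset.range p.2.length).filter (fun j => IsBreak p.2 j)).card = b) then H (p.1 ++ p.2) else 0) := by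
  refine tsum_eq_tsum_of_ne_zero_bij
    (fun p : support (fun p : List Step × List Step =>
      if IsIrrBridge p.1 ∧ (IsSAW p.2 ∧ IsBridgeW p.2 ∧ p.2 ≠ [] ∧ ((Finset.range p.2.length).filter (fun j => IsBreak p.2 j)).card = b) then H (p.1 ++ p.2) else 0) => p.1.1 ++ p.1.2) ?_ ?_ ?_
  · rintro ⟨⟨s, t⟩, hst⟩ ⟨⟨s', t'⟩, hst'⟩ heq
    have h1 : IsIrrBridge s ∧ (IsSAW t ∧ IsBridgeW t ∧ t ≠ [] ∧ ((Finset.range t.length).filter (fun j => IsBreak t j)).card = b) := by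
      by_contra hc
      exact hst (if_neg hc)
    have h2 : IsIrrBridge s' ∧ (IsSAW t' ∧ IsBridgeW t' ∧ t' ≠ [] ∧ ((Finset.range t'.length).filter (fun j => IsBreak t' j)).card = b) := by
      by_contra hc
      exact hst' (if_neg hc)
    obtain ⟨rfl, rfl⟩ := eq_of_append_eq' h1.1 h2.1 h1.2.2.1 h2.2.2.1 heq
    rfl
  · intro w hw
    obtain ⟨s, t, rfl, hs, ht⟩ := exists_append_of_breaks_succ (hH w hw)
    refine ⟨⟨(s, t), ?_⟩, rfl⟩
    show (if IsIrrBridge (s, t).1 ∧ (IsSAW ((s, t).2) ∧ IsBridgeW ((s, t).2) ∧ (s, t).2 ≠ [] ∧ ((Finset.range ((s, t).2).length).filter (fun j => IsBreak ((s, t).2) j)).card = b) then H ((s, t).1 ++ (s, t).2) else 0) ≠ 0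
    rw [if_pos ⟨hs, ht⟩]
    exact hw
  · rintro ⟨⟨s, t⟩, hst⟩
    have h1 : IsIrrBridge s ∧ (IsSAW t ∧ IsBridgeW t ∧ t ≠ [] ∧ ((Finset.range t.length).filter (fun j => IsBreak t j)).card = b) := by
      by_contra hc
      exact hst (if_neg hc)
    show H (s ++ t) = if IsIrrBridge s ∧ (IsSAW t ∧ IsBridgeW t ∧ t ≠ [] ∧ ((Finset.range t.length).filter (fun j => IsBreak t j)).card = b) then H (s ++ t) else 0
    rw [if_pos h1]

/-- `Σ_{(s,t) ∈ Q_0 × Q_b} f(s)ω(s) · g(t)ω(t) = (Σ_{Q_0} f ω)(Σ_{Q_b} g ω)`. [folklore] -/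
theorem tsum_pairs_mul (z m : ℝ) (b : ℕ) (f g : List Step → ℝ≥0∞) :
    ∑' p : List Step × List Step, (if IsIrrBridge p.1 ∧ (IsSAW p.2 ∧ IsBridgeW p.2 ∧ p.2 ≠ [] ∧ ((Finset.range p.2.length).filter (fun j => IsBreak p.2 j)).card = b) then
      f p.1 * ENNReal.ofReal (z ^ p.1.length * Real.exp (m * (xEnd p.1 : ℝ))) * (g p.2 * ENNReal.ofReal (z ^ p.2.length * Real.exp (m * (xEnd p.2 : ℝ)))) else 0)
    = (∑' s, if IsIrrBridge s then f s * ENNReal.ofReal (z ^ s.length * Real.exp (m * (xEnd s : ℝ))) else 0) *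
        ∑' t, (if (IsSAW t ∧ IsBridgeW t ∧ t ≠ [] ∧ ((Finset.range t.length).filter (fun j => IsBreak t j)).card = b) then g t * ENNReal.ofReal (z ^ t.length * Real.exp (m * (xEnd t : ℝ))) else 0) := by
  rw [← tsum_prod_mul]
  refine tsum_congr fun p => ?_
  rw [ite_zero_mul_ite_zero]

/-! ### Moments of the classes `Q_b` -/

/-- **Mass**: `Σ_{Q_b} ω = 1` if `Σ_{Q_0} ω = 1`. [cite: MadrasSlade1993, §4.2, (4.2.15)] -/
theorem tsum_breaks_twt {z m : ℝ} (hz : 0 ≤ z)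
    (h1 : ∑' w, (if IsIrrBridge w then ENNReal.ofReal (z ^ w.length * Real.exp (m * (xEnd w : ℝ))) else 0) = 1) (b : ℕ) :
    ∑' w, (if (IsSAW w ∧ IsBridgeW w ∧ w ≠ [] ∧ ((Finset.range w.length).filter (fun j => IsBreak w j)).card = b) then ENNReal.ofReal (z ^ w.length * Real.exp (m * (xEnd w : ℝ))) else 0) = 1 := by
  induction b with
  | zero =>
    rw [← h1]
    exact tsum_congr fun w => if_congr breaks_zero_iff rfl rfl
  | succ b ih =>
    rw [tsum_eq_tsum_pairs b _ (fun w hw => by by_contra hc; exact hw (if_neg hc))]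
    have key : ∀ p : List Step × List Step,
        (if IsIrrBridge p.1 ∧ (IsSAW p.2 ∧ IsBridgeW p.2 ∧ p.2 ≠ [] ∧ ((Finset.range p.2.length).filter (fun j => IsBreak p.2 j)).card = b) then
          (if (IsSAW (p.1 ++ p.2) ∧ IsBridgeW (p.1 ++ p.2) ∧ p.1 ++ p.2 ≠ [] ∧ ((Finset.range (p.1 ++ p.2).length).filter (fun j => IsBreak (p.1 ++ p.2) j)).card = b + 1) then ENNReal.ofReal (z ^ (p.1 ++ p.2).length * Real.exp (m * (xEnd (p.1 ++ p.2) : ℝ))) else 0) else 0)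
        = (if IsIrrBridge p.1 ∧ (IsSAW p.2 ∧ IsBridgeW p.2 ∧ p.2 ≠ [] ∧ ((Finset.range p.2.length).filter (fun j => IsBreak p.2 j)).card = b) then
          1 * ENNReal.ofReal (z ^ p.1.length * Real.exp (m * (xEnd p.1 : ℝ))) * (1 * ENNReal.ofReal (z ^ p.2.length * Real.exp (m * (xEnd p.2 : ℝ)))) else 0) := by
      intro p
      split_ifs with hc hc'
      · rw [one_mul, one_mul, twt_append hz]
      · exact absurd (by simpa only [zero_add] using breaks_append (breaks_zero_iff.2 hc.1) hc.2) hc'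
      · rfl
    rw [tsum_congr key, tsum_pairs_mul z m b (fun _ => 1) (fun _ => 1)]
    simp only [one_mul]
    rw [h1, ih, one_mul]

/-- **First moment**: `Σ_{Q_b} span·ω = (b+1) s₁`. [cite: MadrasSlade1993, §4.2] -/
theorem tsum_breaks_x_twt {z m : ℝ} (hz : 0 ≤ z) {s₁ : ℝ≥0∞}
    (h1 : ∑' w, (if IsIrrBridge w then ENNReal.ofReal (z ^ w.length * Real.exp (m * (xEnd w : ℝ))) else 0) = 1)
    (hs₁ : ∑' w, (if IsIrrBridge w then ENNReal.ofReal (xEnd w : ℝ) * ENNReal.ofReal (z ^ w.length * Real.exp (m * (xEnd w : ℝ))) else 0) = s₁) (b : ℕ) :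
    ∑' w, (if (IsSAW w ∧ IsBridgeW w ∧ w ≠ [] ∧ ((Finset.range w.length).filter (fun j => IsBreak w j)).card = b) then ENNReal.ofReal (xEnd w : ℝ) * ENNReal.ofReal (z ^ w.length * Real.exp (m * (xEnd w : ℝ))) else 0) = (b + 1) * s₁ := by
  induction b with
  | zero =>
    rw [Nat.cast_zero, zero_add, one_mul, ← hs₁]
    exact tsum_congr fun w => if_congr breaks_zero_iff rfl rfl
  | succ b ih =>
    rw [tsum_eq_tsum_pairs b _ (fun w hw => by by_contra hc; exact hw (if_neg hc))]
    have key : ∀ p : List Step × List Step,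
        (if IsIrrBridge p.1 ∧ (IsSAW p.2 ∧ IsBridgeW p.2 ∧ p.2 ≠ [] ∧ ((Finset.range p.2.length).filter (fun j => IsBreak p.2 j)).card = b) then
          (if (IsSAW (p.1 ++ p.2) ∧ IsBridgeW (p.1 ++ p.2) ∧ p.1 ++ p.2 ≠ [] ∧ ((Finset.range (p.1 ++ p.2).length).filter (fun j => IsBreak (p.1 ++ p.2) j)).card = b + 1) then ENNReal.ofReal (xEnd (p.1 ++ p.2) : ℝ) * ENNReal.ofReal (z ^ (p.1 ++ p.2).length * Real.exp (m * (xEnd (p.1 ++ p.2) : ℝ))) else 0) else 0)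
        = (if IsIrrBridge p.1 ∧ (IsSAW p.2 ∧ IsBridgeW p.2 ∧ p.2 ≠ [] ∧ ((Finset.range p.2.length).filter (fun j => IsBreak p.2 j)).card = b) then
            ENNReal.ofReal (xEnd p.1 : ℝ) * ENNReal.ofReal (z ^ p.1.length * Real.exp (m * (xEnd p.1 : ℝ))) * (1 * ENNReal.ofReal (z ^ p.2.length * Real.exp (m * (xEnd p.2 : ℝ)))) else 0)
          + (if IsIrrBridge p.1 ∧ (IsSAW p.2 ∧ IsBridgeW p.2 ∧ p.2 ≠ [] ∧ ((Finset.range p.2.length).filter (fun j => IsBreak p.2 j)).card = b) then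
            1 * ENNReal.ofReal (z ^ p.1.length * Real.exp (m * (xEnd p.1 : ℝ))) * (ENNReal.ofReal (xEnd p.2 : ℝ) * ENNReal.ofReal (z ^ p.2.length * Real.exp (m * (xEnd p.2 : ℝ)))) else 0) := by
      intro p
      split_ifs with hc hc'
      · rw [x_append hc.1.bridge hc.2.2.1, twt_append hz]
        ring
      · exact absurd (by simpa only [zero_add] using breaks_append (breaks_zero_iff.2 hc.1) hc.2) hc'
      · rw [add_zero]
    rw [tsum_congr key, ENNReal.tsum_add, tsum_pairs_mul z m b (fun s => ENNReal.ofReal (xEnd s : ℝ)) (fun _ => 1),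
      tsum_pairs_mul z m b (fun _ => 1) (fun t => ENNReal.ofReal (xEnd t : ℝ))]
    simp only [one_mul]
    rw [h1, hs₁, ih, tsum_breaks_twt hz h1 b]
    push_cast
    ring

/-- **Second moment**: `Σ_{Q_b} span²·ω = (b+1) s₂ + (b+1) b s₁²`. [cite: MadrasSlade1993, §4.2] -/
theorem tsum_breaks_sq_twt {z m : ℝ} (hz : 0 ≤ z) {s₁ s₂ : ℝ≥0∞}
    (h1 : ∑' w, (if IsIrrBridge w then ENNReal.ofReal (z ^ w.length * Real.exp (m * (xEnd w : ℝ))) else 0) = 1)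
    (hs₁ : ∑' w, (if IsIrrBridge w then ENNReal.ofReal (xEnd w : ℝ) * ENNReal.ofReal (z ^ w.length * Real.exp (m * (xEnd w : ℝ))) else 0) = s₁)
    (hs₂ : ∑' w, (if IsIrrBridge w then ENNReal.ofReal (xEnd w : ℝ) ^ 2 * ENNReal.ofReal (z ^ w.length * Real.exp (m * (xEnd w : ℝ))) else 0) = s₂) (b : ℕ) :
    ∑' w, (if (IsSAW w ∧ IsBridgeW w ∧ w ≠ [] ∧ ((Finset.range w.length).filter (fun j => IsBreak w j)).card = b) then ENNReal.ofReal (xEnd w : ℝ) ^ 2 * ENNReal.ofReal (z ^ w.length * Real.exp (m * (xEnd w : ℝ))) else 0) = (b + 1) * s₂ + (b + 1) * b * s₁ ^ 2 := by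
  induction b with
  | zero =>
    rw [Nat.cast_zero, zero_add, one_mul, mul_zero, zero_mul, add_zero, ← hs₂]
    exact tsum_congr fun w => if_congr breaks_zero_iff rfl rfl
  | succ b ih =>
    rw [tsum_eq_tsum_pairs b _ (fun w hw => by by_contra hc; exact hw (if_neg hc))]
    have key : ∀ p : List Step × List Step,
        (if IsIrrBridge p.1 ∧ (IsSAW p.2 ∧ IsBridgeW p.2 ∧ p.2 ≠ [] ∧ ((Finset.range p.2.length).filter (fun j => IsBreak p.2 j)).card = b) then
          (if (IsSAW (p.1 ++ p.2) ∧ IsBridgeW (p.1 ++ p.2) ∧ p.1 ++ p.2 ≠ [] ∧ ((Finset.range (p.1 ++ p.2).length).filter (fun j => IsBreak (p.1 ++ p.2) j)).card = b + 1) then ENNReal.ofReal (xEnd (p.1 ++ p.2) : ℝ) ^ 2 * ENNReal.ofReal (z ^ (p.1 ++ p.2).length * Real.exp (m * (xEnd (p.1 ++ p.2) : ℝ))) else 0) else 0)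
        = (if IsIrrBridge p.1 ∧ (IsSAW p.2 ∧ IsBridgeW p.2 ∧ p.2 ≠ [] ∧ ((Finset.range p.2.length).filter (fun j => IsBreak p.2 j)).card = b) then
            ENNReal.ofReal (xEnd p.1 : ℝ) ^ 2 * ENNReal.ofReal (z ^ p.1.length * Real.exp (m * (xEnd p.1 : ℝ))) * (1 * ENNReal.ofReal (z ^ p.2.length * Real.exp (m * (xEnd p.2 : ℝ)))) else 0)
          + 2 * (if IsIrrBridge p.1 ∧ (IsSAW p.2 ∧ IsBridgeW p.2 ∧ p.2 ≠ [] ∧ ((Finset.range p.2.length).filter (fun j => IsBreak p.2 j)).card = b) then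
            ENNReal.ofReal (xEnd p.1 : ℝ) * ENNReal.ofReal (z ^ p.1.length * Real.exp (m * (xEnd p.1 : ℝ))) * (ENNReal.ofReal (xEnd p.2 : ℝ) * ENNReal.ofReal (z ^ p.2.length * Real.exp (m * (xEnd p.2 : ℝ)))) else 0)
          + (if IsIrrBridge p.1 ∧ (IsSAW p.2 ∧ IsBridgeW p.2 ∧ p.2 ≠ [] ∧ ((Finset.range p.2.length).filter (fun j => IsBreak p.2 j)).card = b) then
            1 * ENNReal.ofReal (z ^ p.1.length * Real.exp (m * (xEnd p.1 : ℝ))) * (ENNReal.ofReal (xEnd p.2 : ℝ) ^ 2 * ENNReal.ofReal (z ^ p.2.length * Real.exp (m * (xEnd p.2 : ℝ)))) else 0) := by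
      intro p
      split_ifs with hc hc'
      · rw [x_append hc.1.bridge hc.2.2.1, twt_append hz]
        ring
      · exact absurd (by simpa only [zero_add] using breaks_append (breaks_zero_iff.2 hc.1) hc.2) hc'
      · rw [mul_zero, add_zero, add_zero]
    rw [tsum_congr key, ENNReal.tsum_add, ENNReal.tsum_add, ENNReal.tsum_mul_left,
      tsum_pairs_mul z m b (fun s => ENNReal.ofReal (xEnd s : ℝ) ^ 2) (fun _ => 1),
      tsum_pairs_mul z m b (fun s => ENNReal.ofReal (xEnd s : ℝ)) (fun t => ENNReal.ofReal (xEnd t : ℝ)),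
      tsum_pairs_mul z m b (fun _ => 1) (fun t => ENNReal.ofReal (xEnd t : ℝ) ^ 2)]
    simp only [one_mul]
    rw [h1, hs₁, hs₂, ih, tsum_breaks_twt hz h1 b, tsum_breaks_x_twt hz h1 hs₁ b]
    push_cast
    ring

/-! ### Variance identity, Cauchy–Schwarz, Chebyshev -/

/-- `2 · A · A = 2A²` through `ENNReal.ofReal` (`A ≥ 0`). [folklore] -/
theorem two_mul_ofReal_mul_ofReal {A : ℝ} (hA : 0 ≤ A) :
    (2 : ℝ≥0∞) * ENNReal.ofReal A * ENNReal.ofReal A = ENNReal.ofReal (2 * A ^ 2) := by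
  rw [show (2 : ℝ) * A ^ 2 = 2 * (A * A) by ring, ENNReal.ofReal_mul (by norm_num : (0 : ℝ) ≤ 2),
    ENNReal.ofReal_mul hA, ENNReal.ofReal_ofNat, mul_assoc]

/-- **Variance identity** on `Q_b` (`a ≥ 0`):
`Σ (span - a)² ω + 2a · Σ span ω = Σ span² ω + a² · Σ ω` (termwise `(x - a)² + 2ax = x² + a²`).
[folklore] -/
theorem tsum_sq_sub_add (z m : ℝ) (b : ℕ) {a : ℝ} (ha : 0 ≤ a) :
    ∑' w, (if (IsSAW w ∧ IsBridgeW w ∧ w ≠ [] ∧ ((Finset.range w.length).filter (fun j => IsBreak w j)).card = b) then ENNReal.ofReal (((xEnd w : ℝ) - a) ^ 2) * ENNReal.ofReal (z ^ w.length * Real.exp (m * (xEnd w : ℝ))) else 0)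
      + 2 * ENNReal.ofReal a * ∑' w, (if (IsSAW w ∧ IsBridgeW w ∧ w ≠ [] ∧ ((Finset.range w.length).filter (fun j => IsBreak w j)).card = b) then ENNReal.ofReal (xEnd w : ℝ) * ENNReal.ofReal (z ^ w.length * Real.exp (m * (xEnd w : ℝ))) else 0)
    = ∑' w, (if (IsSAW w ∧ IsBridgeW w ∧ w ≠ [] ∧ ((Finset.range w.length).filter (fun j => IsBreak w j)).card = b) then ENNReal.ofReal (xEnd w : ℝ) ^ 2 * ENNReal.ofReal (z ^ w.length * Real.exp (m * (xEnd w : ℝ))) else 0)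
      + ENNReal.ofReal (a ^ 2) * ∑' w, (if (IsSAW w ∧ IsBridgeW w ∧ w ≠ [] ∧ ((Finset.range w.length).filter (fun j => IsBreak w j)).card = b) then ENNReal.ofReal (z ^ w.length * Real.exp (m * (xEnd w : ℝ))) else 0) := by
  rw [← ENNReal.tsum_mul_left, ← ENNReal.tsum_mul_left, ← ENNReal.tsum_add, ← ENNReal.tsum_add]
  refine tsum_congr fun w => ?_
  split_ifs with hw
  · have hx : (0 : ℝ) ≤ (xEnd w : ℝ) := by exact_mod_cast hw.2.1.xEnd_nonneg
    have h2 : (2 : ℝ≥0∞) * ENNReal.ofReal a * ENNReal.ofReal (xEnd w : ℝ) =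
        ENNReal.ofReal (2 * a * (xEnd w : ℝ)) := by
      rw [ENNReal.ofReal_mul (by positivity), ENNReal.ofReal_mul (by norm_num), ENNReal.ofReal_ofNat]
    have key : ENNReal.ofReal (((xEnd w : ℝ) - a) ^ 2) + 2 * ENNReal.ofReal a * ENNReal.ofReal (xEnd w : ℝ)
        = ENNReal.ofReal (xEnd w : ℝ) ^ 2 + ENNReal.ofReal (a ^ 2) := by
      rw [h2, ← ENNReal.ofReal_add (sq_nonneg _) (by positivity), ← ENNReal.ofReal_pow hx,
        ← ENNReal.ofReal_add (by positivity) (by positivity)]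
      congr 1
      ring
    calc ENNReal.ofReal (((xEnd w : ℝ) - a) ^ 2) * ENNReal.ofReal (z ^ w.length * Real.exp (m * (xEnd w : ℝ)))
          + 2 * ENNReal.ofReal a * (ENNReal.ofReal (xEnd w : ℝ) * ENNReal.ofReal (z ^ w.length * Real.exp (m * (xEnd w : ℝ))))
        = (ENNReal.ofReal (((xEnd w : ℝ) - a) ^ 2)
            + 2 * ENNReal.ofReal a * ENNReal.ofReal (xEnd w : ℝ)) * ENNReal.ofReal (z ^ w.length * Real.exp (m * (xEnd w : ℝ))) := by ring
      _ = _ := by rw [key]; ring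
  · rw [mul_zero, add_zero, mul_zero, add_zero]

/-- **Cauchy–Schwarz** for the tilted span law: if `Σ_{Q_0} ω = 1`, `Σ_{Q_0} span ω = S₁`,
`Σ_{Q_0} span² ω = S₂` (`S₁, S₂ ≥ 0` real) then `S₁² ≤ S₂` (the variance identity at `a = S₁`).
[folklore] -/
theorem sq_le_of_tsums {z m : ℝ} (hz : 0 ≤ z) {S₁ S₂ : ℝ} (hS₁0 : 0 ≤ S₁) (hS₂0 : 0 ≤ S₂)
    (h1 : ∑' w, (if IsIrrBridge w then ENNReal.ofReal (z ^ w.length * Real.exp (m * (xEnd w : ℝ))) else 0) = 1)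
    (hS₁ : ∑' w, (if IsIrrBridge w then ENNReal.ofReal (xEnd w : ℝ) * ENNReal.ofReal (z ^ w.length * Real.exp (m * (xEnd w : ℝ))) else 0) = ENNReal.ofReal S₁)
    (hS₂ : ∑' w, (if IsIrrBridge w then ENNReal.ofReal (xEnd w : ℝ) ^ 2 * ENNReal.ofReal (z ^ w.length * Real.exp (m * (xEnd w : ℝ))) else 0) = ENNReal.ofReal S₂) :
    S₁ ^ 2 ≤ S₂ := by
  have key := tsum_sq_sub_add z m 0 hS₁0
  rw [tsum_breaks_twt hz h1 0, tsum_breaks_x_twt hz h1 hS₁ 0, tsum_breaks_sq_twt hz h1 hS₁ hS₂ 0]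
    at key
  simp only [Nat.cast_zero, zero_add, one_mul, mul_zero, zero_mul, add_zero, mul_one] at key
  have hle : 2 * ENNReal.ofReal S₁ * ENNReal.ofReal S₁ ≤ ENNReal.ofReal S₂ + ENNReal.ofReal (S₁ ^ 2) :=
    le_of_le_of_eq le_add_self key
  rw [← ENNReal.ofReal_ofNat, ← ENNReal.ofReal_mul (by norm_num), ← ENNReal.ofReal_mul (by positivity),
    ← ENNReal.ofReal_add hS₂0 (by positivity), ENNReal.ofReal_le_ofReal_iff (by positivity)] at hle
  nlinarith

/-- **Chebyshev on `Q_b`** ("`b + 1` i.i.d. irreducible pieces"): if `Σ_{Q_0} ω = 1`,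
`Σ_{Q_0} span ω = S₁`, `Σ_{Q_0} span² ω = S₂`, then for `t > 0` the `ω`-mass of the words of
`Q_b` whose span deviates from `(b+1) S₁` by at least `t` is `≤ (b+1) S₂ / t²` (the variance of the
span on `Q_b` is `(b+1)(S₂ - S₁²) ≤ (b+1) S₂`). [folklore] -/
theorem tsum_tail_le {z m : ℝ} (hz : 0 ≤ z) {S₁ S₂ : ℝ} (hS₁0 : 0 ≤ S₁) (hS₂0 : 0 ≤ S₂)
    (h1 : ∑' w, (if IsIrrBridge w then ENNReal.ofReal (z ^ w.length * Real.exp (m * (xEnd w : ℝ))) else 0) = 1)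
    (hS₁ : ∑' w, (if IsIrrBridge w then ENNReal.ofReal (xEnd w : ℝ) * ENNReal.ofReal (z ^ w.length * Real.exp (m * (xEnd w : ℝ))) else 0) = ENNReal.ofReal S₁)
    (hS₂ : ∑' w, (if IsIrrBridge w then ENNReal.ofReal (xEnd w : ℝ) ^ 2 * ENNReal.ofReal (z ^ w.length * Real.exp (m * (xEnd w : ℝ))) else 0) = ENNReal.ofReal S₂)
    (b : ℕ) {t : ℝ} (ht : 0 < t) :
    ∑' w, (if (IsSAW w ∧ IsBridgeW w ∧ w ≠ [] ∧ ((Finset.range w.length).filter (fun j => IsBreak w j)).card = b) ∧ t ≤ |(xEnd w : ℝ) - (b + 1) * S₁| then ENNReal.ofReal (z ^ w.length * Real.exp (m * (xEnd w : ℝ))) else 0)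
      ≤ ENNReal.ofReal ((b + 1) * S₂ / t ^ 2) := by
  have ha : (0 : ℝ) ≤ (b + 1) * S₁ := by positivity
  -- the variance bound
  have key := tsum_sq_sub_add z m b ha
  rw [tsum_breaks_twt hz h1 b, tsum_breaks_x_twt hz h1 hS₁ b, tsum_breaks_sq_twt hz h1 hS₁ hS₂ b,
    mul_one] at key
  have e1 : ((b : ℝ≥0∞) + 1) * ENNReal.ofReal S₁ = ENNReal.ofReal ((b + 1) * S₁) := by
    rw [ENNReal.ofReal_mul (by positivity)]
    congr 1
    rw [← ENNReal.ofReal_natCast, ← ENNReal.ofReal_one, ← ENNReal.ofReal_add (by positivity) zero_le_one]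
  have e2 : ((b : ℝ≥0∞) + 1) * ENNReal.ofReal S₂ + ((b : ℝ≥0∞) + 1) * b * ENNReal.ofReal S₁ ^ 2
      = ENNReal.ofReal ((b + 1) * S₂ + (b + 1) * b * S₁ ^ 2) := by
    have hb : ((b : ℝ≥0∞) + 1) = ENNReal.ofReal (b + 1) := by
      rw [← ENNReal.ofReal_natCast, ← ENNReal.ofReal_one, ← ENNReal.ofReal_add (by positivity) zero_le_one]
    rw [hb, ← ENNReal.ofReal_natCast, ← ENNReal.ofReal_pow hS₁0, ← ENNReal.ofReal_mul (by positivity),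
      ← ENNReal.ofReal_mul (by positivity), ← ENNReal.ofReal_mul (by positivity),
      ← ENNReal.ofReal_add (by positivity) (by positivity)]
  have e3 : (2 : ℝ≥0∞) * ENNReal.ofReal ((b + 1) * S₁) * ENNReal.ofReal ((b + 1) * S₁)
      = ENNReal.ofReal (2 * ((b + 1) * S₁) ^ 2) := two_mul_ofReal_mul_ofReal ha
  rw [e1, e2, e3] at key
  have hV : ∑' w, (if (IsSAW w ∧ IsBridgeW w ∧ w ≠ [] ∧ ((Finset.range w.length).filter (fun j => IsBreak w j)).card = b) then ENNReal.ofReal (((xEnd w : ℝ) - (b + 1) * S₁) ^ 2) * ENNReal.ofReal (z ^ w.length * Real.exp (m * (xEnd w : ℝ)))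
      else 0) ≤ ENNReal.ofReal ((b + 1) * S₂) := by
    have hfin : ENNReal.ofReal (2 * ((b + 1) * S₁) ^ 2) ≠ ∞ := ENNReal.ofReal_ne_top
    rw [← ENNReal.add_le_add_iff_right hfin, key, ← ENNReal.ofReal_add (by positivity) (by positivity),
      ← ENNReal.ofReal_add (by positivity) (by positivity)]
    refine ENNReal.ofReal_le_ofReal ?_
    nlinarith [sq_nonneg S₁, mul_nonneg (Nat.cast_nonneg b : (0 : ℝ) ≤ b) (sq_nonneg S₁)]
  -- Chebyshev
  have htail : ENNReal.ofReal (t ^ 2) *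
      ∑' w, (if (IsSAW w ∧ IsBridgeW w ∧ w ≠ [] ∧ ((Finset.range w.length).filter (fun j => IsBreak w j)).card = b) ∧ t ≤ |(xEnd w : ℝ) - (b + 1) * S₁| then ENNReal.ofReal (z ^ w.length * Real.exp (m * (xEnd w : ℝ))) else 0)
      ≤ ∑' w, (if (IsSAW w ∧ IsBridgeW w ∧ w ≠ [] ∧ ((Finset.range w.length).filter (fun j => IsBreak w j)).card = b) then ENNReal.ofReal (((xEnd w : ℝ) - (b + 1) * S₁) ^ 2) * ENNReal.ofReal (z ^ w.length * Real.exp (m * (xEnd w : ℝ)))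
        else 0) := by
    rw [← ENNReal.tsum_mul_left]
    refine ENNReal.tsum_le_tsum fun w => ?_
    split_ifs with hw hw'
    · refine mul_le_mul' (ENNReal.ofReal_le_ofReal ?_) le_rfl
      rw [← sq_abs ((xEnd w : ℝ) - (b + 1) * S₁)]
      exact pow_le_pow_left₀ ht.le hw.2 2
    · exact absurd hw.1 hw'
    · simp
    · simp
  have ht2 : 0 < t ^ 2 := by positivity
  rw [ENNReal.ofReal_div_of_pos ht2, ENNReal.le_div_iff_mul_le (Or.inl ((ENNReal.ofReal_pos.2 ht2).ne'))
    (Or.inl ENNReal.ofReal_ne_top), mul_comm]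
  exact htail.trans hV

/-- The `ω`-mass of `Q_b` splits into the words with `|span - a| < t` and those with
`|span - a| ≥ t`. [folklore] -/
theorem tsum_good_add_tsum_tail (z m : ℝ) (b : ℕ) (a t : ℝ) :
    ∑' w, (if (IsSAW w ∧ IsBridgeW w ∧ w ≠ [] ∧ ((Finset.range w.length).filter (fun j => IsBreak w j)).card = b) ∧ |(xEnd w : ℝ) - a| < t then ENNReal.ofReal (z ^ w.length * Real.exp (m * (xEnd w : ℝ))) else 0)
      + ∑' w, (if (IsSAW w ∧ IsBridgeW w ∧ w ≠ [] ∧ ((Finset.range w.length).filter (fun j => IsBreak w j)).card = b) ∧ t ≤ |(xEnd w : ℝ) - a| then ENNReal.ofReal (z ^ w.length * Real.exp (m * (xEnd w : ℝ))) else 0)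
    = ∑' w, (if (IsSAW w ∧ IsBridgeW w ∧ w ≠ [] ∧ ((Finset.range w.length).filter (fun j => IsBreak w j)).card = b) then ENNReal.ofReal (z ^ w.length * Real.exp (m * (xEnd w : ℝ))) else 0) := by
  rw [← ENNReal.tsum_add]
  refine tsum_congr fun w => ?_
  by_cases hw : (IsSAW w ∧ IsBridgeW w ∧ w ≠ [] ∧ ((Finset.range w.length).filter (fun j => IsBreak w j)).card = b)
  · by_cases ht : |(xEnd w : ℝ) - a| < t
    · rw [if_pos ⟨hw, ht⟩, if_neg (fun h => not_le.2 ht h.2), if_pos hw, add_zero]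
    · rw [if_neg (fun h => ht h.2), if_pos ⟨hw, not_lt.1 ht⟩, if_pos hw, zero_add]
  · rw [if_neg (fun h => hw h.1), if_neg (fun h => hw h.1), if_neg hw, add_zero]

/-! ### Un-tilting and partial sums -/

/-- **Un-tilting on `F_D`.** For `0 ≤ z ≤ x_c`, `m ≥ 0`, a word of span `< 2D` has tilted weight
`z^{|w|} e^{m·span} ≤ e^{2mD} x_c^{|w|}`. [folklore] -/
theorem tsum_fd_twt_le {z m : ℝ} (hz : 0 ≤ z) (hzc : z ≤ criticalFugacity) (hm : 0 ≤ m) (D : ℕ) :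
    ∑' w, (if IsSAW w ∧ (IsBridgeW w ∧ (D : ℤ) ≤ xEnd w ∧ xEnd w < 2 * (D : ℤ) ∧
        ∀ j, IsBreak w j → xAt w j < (D : ℤ)) then ENNReal.ofReal (z ^ w.length * Real.exp (m * (xEnd w : ℝ))) else 0)
      ≤ ENNReal.ofReal (Real.exp (m * (2 * (D : ℝ)))) *
        ∑' w, (if IsSAW w ∧ (IsBridgeW w ∧ (D : ℤ) ≤ xEnd w ∧ xEnd w < 2 * (D : ℤ) ∧
          ∀ j, IsBreak w j → xAt w j < (D : ℤ)) then ENNReal.ofReal (criticalFugacity ^ w.length)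
          else 0) := by
  rw [← ENNReal.tsum_mul_left]
  refine ENNReal.tsum_le_tsum fun w => ?_
  split_ifs with hw
  · rw [← ENNReal.ofReal_mul (Real.exp_nonneg _)]
    refine ENNReal.ofReal_le_ofReal ?_
    have h2D : (xEnd w : ℝ) ≤ 2 * (D : ℝ) := by
      have := hw.2.2.2.1
      exact_mod_cast this.le
    calc z ^ w.length * Real.exp (m * (xEnd w : ℝ))
        ≤ criticalFugacity ^ w.length * Real.exp (m * (2 * (D : ℝ))) :=
          mul_le_mul (pow_le_pow_left₀ hz hzc _) (Real.exp_le_exp.2 (mul_le_mul_of_nonneg_left h2D hm))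
            (Real.exp_nonneg _) (pow_nonneg StripMass.criticalFugacity_pos.le _)
      _ = Real.exp (m * (2 * (D : ℝ))) * criticalFugacity ^ w.length := mul_comm _ _
  · simp

/-- **Back to partial sums.** If the critical mass `Σ_{w self-avoiding, P w} x_c^{|w|}` (in `ℝ≥0∞`)
exceeds `c ≥ 0`, some partial sum `Σ_{n ≤ N} Σ_{w ∈ sawWords n, P w} x_c^n` exceeds `c`. [folklore] -/
theorem exists_partialSum_gt (P : List Step → Prop) [DecidablePred P] {c : ℝ} (hc : 0 ≤ c)
    (h : ENNReal.ofReal c <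
      ∑' w, (if IsSAW w ∧ P w then ENNReal.ofReal (criticalFugacity ^ w.length) else 0)) :
    ∃ N : ℕ, c < ∑ n ∈ Finset.range (N + 1), ∑ _w ∈ (sawWords n).filter P, criticalFugacity ^ n := by
  have hxc := StripMass.criticalFugacity_pos.le
  rw [tsum_words_eq_tsum_length, ENNReal.tsum_eq_iSup_nat, lt_iSup_iff] at h
  obtain ⟨N, hN⟩ := h
  refine ⟨N, ?_⟩
  have e : ∀ n, ∑ w ∈ words n, (if IsSAW w ∧ P w then ENNReal.ofReal (criticalFugacity ^ w.length)
      else 0) = ENNReal.ofReal (∑ _w ∈ (sawWords n).filter P, criticalFugacity ^ n) := by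
    intro n
    rw [ENNReal.ofReal_sum_of_nonneg (fun _ _ => pow_nonneg hxc _), sawWords, Finset.filter_filter,
      Finset.sum_filter]
    refine Finset.sum_congr rfl fun w hw => ?_
    rw [mem_words.1 hw]
  simp only [e] at hN
  rw [← ENNReal.ofReal_sum_of_nonneg (fun _ _ => Finset.sum_nonneg fun _ _ => pow_nonneg hxc _),
    ENNReal.ofReal_lt_ofReal_iff_of_nonneg hc] at hN
  refine hN.trans_le (Finset.sum_le_sum_of_subset_of_nonneg
    (Finset.range_subset_range.2 (Nat.le_succ N)) fun _ _ _ => ?_)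
  exact Finset.sum_nonneg fun _ _ => pow_nonneg hxc _

end BPD

/-! ### Registered sub-goal of part II -/

/-- **Mass of the `b`-break-point classes** (the registered sub-goal `bpd_piecesMass` of the crux
item, part II of the sub-goal `breakPointDensity_of_spanHyperscaling`; `BPD.tsum_breaks_twt` in
closed form): if the tilted weights `z^{|w|} e^{m·span(w)}` (`z ≥ 0`) of the irreducible bridges sum
to `1`, then for every `b` so do those of the non-empty self-avoiding bridge words with exactly `b`
break points (`b + 1` i.i.d. irreducible pieces, by Kesten's unique factorisation).
[cite: MadrasSlade1993, §4.2, (4.2.15)] -/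
theorem bpd_piecesMass :
    ∀ (z m : ℝ) (b : ℕ), 0 ≤ z → (∑' w : List Step, if IsIrrBridge w then ENNReal.ofReal (z ^ w.length * Real.exp (m * (xEnd w : ℝ))) else 0) = 1 → (∑' w : List Step, if IsSAW w ∧ IsBridgeW w ∧ w ≠ [] ∧ ((Finset.range w.length).filter (fun j => IsBreak w j)).card = b then ENNReal.ofReal (z ^ w.length * Real.exp (m * (xEnd w : ℝ))) else 0) = 1 :=
  fun _ _ b hz h1 => BPD.tsum_breaks_twt hz h1 b

end Summit.CriticalPhenomena.SAWScalingLimit.Theorems.TubeLowerBound.SubcriticalRenewalFloor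

end
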